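import Literature.ModelTheory.FiniteModelTheory.CapturingPTIME
import HarnessLib

/-!
# Choiceless Polynomial Time with counting (BGS machines over `HF(A)`): an INTERFACE

Topic `Literature/ModelTheory/FiniteModelTheory`; part 2 of definition request `wi-03769` (route
PneNP/Descriptive crux #2), part 1 being the concrete Cai–Fürer–Immerman graphs (`CFI.lean`).

Blass–Gurevich–Shelah (1999, §§4–5; with counting: §4.8 / Blass–Gurevich–Shelah 2002) define
CHOICELESS POLYNOMIAL TIME (with cardinality), C̃PT+Card: abstract-state-machine programs whose
states are hereditarily finite sets over the (unordered!) universe `A` of the input structure,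
run for polynomially many steps activating polynomially many objects, with the counting function
`Card`. A Boolean query is CPT+Card-definable if such a bounded program accepts exactly its
members. Its known structural properties (loc. cit.): every definable query is
ISOMORPHISM-INVARIANT (§4, choicelessness) and POLYNOMIAL-TIME decidable (§5, Thm. on the
simulation of bounded BGS programs by PTIME machines — indeed CPT+Card is a Gurevich logic,
sentences = bounded programs, effectively evaluable), and the definable queries are closed under
Boolean combinations (sequential composition / conditionals of programs) and contain all
FO(IFP)+C-definable queries (§6–7). Whether CPT+Card CAPTURES `P` is OPEN (BGS 1999, §1;
Dawar–Richerby–Rossman 2008: the CFI query is CPT+Card-definable; Lichter 2021 separates RANK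
logic, not CPT, from `P`).

Formalising BGS machines (HF-sets over `A`, ASM terms with comprehension, step semantics, the two
polynomial bounds, `Card`) is a size-L construction left to a separate CONSTRUCTION item, as
sanctioned by the request (D-0014: interface + construction). Here we record the INTERFACE the
route needs, over finite graphs and relative to a clocked universal machine `U` (as in
`CapturingPTIME.lean`):

* `CPTInterface U` — a `GurevichLogic U` (decidable sentences, iso-invariant satisfaction,
  effective P-evaluation) TOGETHER WITH the closure properties BGS prove for CPT+Card:
  complement, intersection, union of definable classes are definable, and the two trivial
  classes are. NOTHING in the structure pins it to BE CPT+Card: FO, FO(IFP)+C, or any Gurevich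
  logic closed under Boolean operations inhabits it. Accordingly:
* `CPTInterface.Definable`, `CPTInterface.CapturesPTIME` (:= `CapturesPTIMEOnGraphs` of the
  underlying logic), and the honest form of the route's open question,
  `IsCPTCard L → (CapturesPTIME L ↔ ?)`, must wait for the construction item, which will
  supply a predicate `IsCPTCard : CPTInterface U → Prop` (or a term). We provide the SHAPE
  `CPTCapturesPTIME (IsCPTCard) := ∀ L, IsCPTCard L → L.CapturesPTIME` so that route statements
  can be written now against a section variable, exactly as the request allows.
* Non-vacuity of the AXIOMS (not of being CPT): any Gurevich logic closed under Boolean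
  connectives with `true`/`false` inhabits `CPTInterface U` — e.g. first-order logic on graphs,
  given a `U`-program evaluating FO sentences in polynomial time; such an instance needs a
  concrete `U`-program and is left with the construction item (cf. `UniversalMachine.nonempty`).

## References

* A. Blass, Y. Gurevich, S. Shelah, *Choiceless polynomial time*, Ann. Pure Appl. Logic 100
  (1999) 141–187, arXiv:math/9705225, §§4–5 (definition), §§6–8 (properties), §1 (the question).
* A. Blass, Y. Gurevich, S. Shelah, *On polynomial time computation over unordered structures*,
  J. Symbolic Logic 67 (2002) 1093–1125 (CPT with counting).
* A. Dawar, D. Richerby, B. Rossman, Ann. Pure Appl. Logic 152 (2008) (CFI ∈ CPT+Card).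
* M. Lichter, *Separating rank logic from polynomial time*, LICS 2021, arXiv:2107.03778.
-/

noncomputable section

open Literature.Computability.MetaComplexity

namespace Literature.ModelTheory.FiniteModelTheory

/-- **Interface for Choiceless Polynomial Time with counting** on finite graphs, relative to a
clocked universal machine `U`: a Gurevich logic (decidable syntax, isomorphism-invariant
semantics, effective polynomial-time evaluation — BGS 1999 §4 (choicelessness ⇒ invariance),
§5 (PTIME simulation of bounded programs)) whose definable classes are closed under complement,
intersection and union and contain `∅` and everything (BGS 1999, §6: programs are closed under
`if-then-else`, sequential and parallel composition). Hypothesis structure: it does NOT pin the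
logic to be CPT+Card (see module doc); a construction item will. [Blass–Gurevich–Shelah 1999,
§§4–6] [cite: arXivmath9705225, §§4–5] -/
structure CPTInterface (U : UniversalMachine) extends GurevichLogic U where
  /-- Definable classes are closed under complement. -/
  compl_mem : ∀ φ ∈ Sen, ∃ ψ ∈ Sen, ∀ G, Sat G ψ ↔ ¬ Sat G φ
  /-- Definable classes are closed under intersection. -/
  and_mem : ∀ φ ∈ Sen, ∀ ψ ∈ Sen, ∃ χ ∈ Sen, ∀ G, Sat G χ ↔ (Sat G φ ∧ Sat G ψ)
  /-- Definable classes are closed under union. -/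
  or_mem : ∀ φ ∈ Sen, ∀ ψ ∈ Sen, ∃ χ ∈ Sen, ∀ G, Sat G χ ↔ (Sat G φ ∨ Sat G ψ)
  /-- The empty query is definable (`false`). -/
  false_mem : ∃ φ ∈ Sen, ∀ G, ¬ Sat G φ
  /-- The full query is definable (`true`). -/
  true_mem : ∃ φ ∈ Sen, ∀ G, Sat G φ

namespace CPTInterface

variable {U : UniversalMachine}

/-- A class of finite graphs is DEFINABLE in `L` (a PREDICATE on the interface `L` and the class
`C`, not a claim). [Blass–Gurevich–Shelah 1999, §4 (Boolean queries computed by bounded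
programs)] [folklore] -/
def Definable (L : CPTInterface U) (C : Set FinGraph) : Prop :=
  ∃ φ ∈ L.Sen, L.toGurevichLogic.ModelClass φ = C

/-- `L` captures PTIME on graphs (as a Gurevich logic): the predicate `CapturesPTIMEOnGraphs` of
the underlying logic, as a PROPERTY OF `L` — a definition, not an assertion, exactly like
`Definable`. (For genuine CPT+Card whether it holds is the open Blass–Gurevich–Shelah question,
cf. `CPTCapturesPTIME`; over ALL interfaces it fails, since any Boolean-closed Gurevich logic —
e.g. one whose sentences denote the constants `true`/`false` — inhabits the structure.) The
binder `L` is explicit, not a section variable, so that the named-fact census reads this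
declaration as a notion and not as a closed `Prop`. [Blass–Gurevich–Shelah 1999, §1] [folklore] -/
def CapturesPTIME (L : CPTInterface U) : Prop :=
  CapturesPTIMEOnGraphs L.toGurevichLogic

variable (L : CPTInterface U)

/-- Definable classes are isomorphism-closed. [Blass–Gurevich–Shelah 1999, §4] [folklore] -/
theorem Definable.isIsoClosed {C : Set FinGraph} (h : L.Definable C) : IsIsoClosed C := by
  obtain ⟨φ, -, rfl⟩ := h
  exact L.toGurevichLogic.isIsoClosed_modelClass φ

/-- Definable classes are closed under complement. [Blass–Gurevich–Shelah 1999, §6] [folklore] -/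
theorem Definable.compl {C : Set FinGraph} (h : L.Definable C) : L.Definable Cᶜ := by
  obtain ⟨φ, hφ, rfl⟩ := h
  obtain ⟨ψ, hψ, hiff⟩ := L.compl_mem φ hφ
  exact ⟨ψ, hψ, Set.ext fun G => hiff G⟩

/-- Definable classes are closed under intersection. [Blass–Gurevich–Shelah 1999, §6] [folklore] -/
theorem Definable.inter {C D : Set FinGraph} (hC : L.Definable C) (hD : L.Definable D) :
    L.Definable (C ∩ D) := by
  obtain ⟨φ, hφ, rfl⟩ := hC
  obtain ⟨ψ, hψ, rfl⟩ := hD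
  obtain ⟨χ, hχ, hiff⟩ := L.and_mem φ hφ ψ hψ
  exact ⟨χ, hχ, Set.ext fun G => hiff G⟩

/-- Definable classes are closed under union. [Blass–Gurevich–Shelah 1999, §6] [folklore] -/
theorem Definable.union {C D : Set FinGraph} (hC : L.Definable C) (hD : L.Definable D) :
    L.Definable (C ∪ D) := by
  obtain ⟨φ, hφ, rfl⟩ := hC
  obtain ⟨ψ, hψ, rfl⟩ := hD
  obtain ⟨χ, hχ, hiff⟩ := L.or_mem φ hφ ψ hψ
  exact ⟨χ, hχ, Set.ext fun G => hiff G⟩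

/-- `∅` is definable. [Blass–Gurevich–Shelah 1999, §6] [folklore] -/
theorem definable_empty : L.Definable ∅ := by
  obtain ⟨φ, hφ, h⟩ := L.false_mem
  exact ⟨φ, hφ, Set.ext fun G => by simpa [GurevichLogic.ModelClass] using h G⟩

/-- Everything is definable. [Blass–Gurevich–Shelah 1999, §6] [folklore] -/
theorem definable_univ : L.Definable Set.univ := by
  obtain ⟨φ, hφ, h⟩ := L.true_mem
  exact ⟨φ, hφ, Set.ext fun G => by simpa [GurevichLogic.ModelClass] using h G⟩

/-- Every definable class is polynomial-time decidable and iso-closed, so capturing FAILS as soon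
as ONE iso-closed PTIME class is not definable — the shape of a CFI-type separation argument.
[Blass–Gurevich–Shelah 1999, §1] [folklore] -/
theorem not_capturesPTIME_of_not_definable {C : Set FinGraph} (hC : IsIsoClosed C)
    (hP : IsPTIMEClass C) (hnd : ¬ L.Definable C) : ¬ L.CapturesPTIME := fun h =>
  hnd (h C hC hP)

end CPTInterface

/-- **The route-facing SHAPE of "CPT+Card captures PTIME"**, against a pinning predicate
`IsCPTCard` to be supplied by the construction item (until then a section variable of the
route): every interface that IS CPT+Card captures PTIME. The Blass–Gurevich–Shelah question is
whether this holds; its negation is the Descriptive route's crux #2. Nothing asserted.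
[Blass–Gurevich–Shelah 1999, §1 (Question)] [cite: arXivmath9705225, §1] -/
def CPTCapturesPTIME {U : UniversalMachine} (IsCPTCard : CPTInterface U → Prop) : Prop :=
  ∀ L : CPTInterface U, IsCPTCard L → L.CapturesPTIME

end Literature.ModelTheory.FiniteModelTheory
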